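import Mathlib
import Summits.ValiantsHypothesis.ValiantsHypothesis.Theorems.BarrierLeverPartitionMinorsHitByVPHiddenStatesFullJoinShell

/-!
# Route BarrierLever — item `PartitionMinorsHitByVP` (stmt-ValiantsHypothesis-19717), line `hidden_states`:
# CONJECTURE FJ FOR ALL TWO-TOP PAIRS — `(B_s(C) ∪ {X₁, X₂}, B_s(C) ∪ {Y₁, Y₂})` by one equal-link step onto first shells

Helper file (`--supports stmt-ValiantsHypothesis-19717`; cell valiant-natproofs, rung V4, 𝒟-side door (c), line
`Cruxes/PartitionMinorsHitByVP/Lines/hidden_states.lean` v8; prover seat val-np-p3 gen 16). Definition-free. Closes NO item.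

THE POINT (memo val-np-p3 g16 «full join» §9, §12–§13). Second infinite family of NON-isomorphic lower pairs with conjecture FJ in the
kernel: for every `C ⊆ Fin h`, radius `s`, and two pairs of distinct `(s+1)`-subsets `X₁ ≠ X₂`, `Y₁ ≠ Y₂` of `C`, the lower families
`B_s(C) ∪ {X₁, X₂}` and `B_s(C) ∪ {Y₁, Y₂}` (any injective enumerations) have a nonsingular one-cube full hidden sum with `h + s + 2` states
(`fullJoinCube_twoTops`). PROOF = ONE equal-link step (p676301) at `a ∈ X₁ ∖ X₂` (rows) and `b ∈ Y₁ ∖ Y₂` (columns) — both of degree one in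
the tops —: the deletion pair is `(B_s(C∖a) ∪ {X₂}, B_s(C∖b) ∪ {Y₂})` and the link pair is `(B_{s−1}(C∖a) ∪ {X₁∖a}, B_{s−1}(C∖b) ∪ {Y₁∖b})`;
after relabelling the column side by the transposition `(a b)` both are FIRST-SHELL pairs over `C ∖ a`, settled by `fullJoinCube_firstShell`
(p677375); `s = 0` is a star leaf (p675793). Through the door: `partitionMinor_hit_twoTops` (`SmallCircuits ℂ (h+h) 8`).

WHAT THIS IS NOT: the general conjecture FJ stays open (three tops a side already need a step this toolkit does not have when no row
coordinate and column coordinate have equal top-degree, e.g. triangle vs. perfect matching at `s = 1`); item 19717 stays OPEN; nothing on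
crux 14610 or VP ≠ VNP.
-/

set_option linter.dupNamespace false

namespace Summit.ValiantsHypothesis.ValiantsHypothesis.Theorems.BarrierLever.HiddenStates

open Finset Matrix

noncomputable section

namespace FullJoin

variable {h : ℕ}

/-! ## 1. Bookkeeping on the families `B_s(C) ∪ {X₁, X₂}` -/

/-- `B_s(C) ∪ {X₁, X₂}` is a lower family when `X₁, X₂ ⊆ C` have size `s + 1`. -/
theorem isLowerSet_twoTops (C X₁ X₂ : Finset (Fin h)) (s : ℕ) (h₁ : X₁ ⊆ C) (h₂ : X₂ ⊆ C) (hX₁ : X₁.card = s + 1)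
    (hX₂ : X₂.card = s + 1) :
    IsLowerSet ((↑(insert X₁ (insert X₂ (C.powerset.filter fun U => U.card ≤ s))) : Set (Finset (Fin h)))) := by
  intro U V hVU hU
  rw [Finset.mem_coe, Finset.mem_insert, Finset.mem_insert, mem_ballF] at hU ⊢
  rcases hU with rfl | rfl | ⟨hUC, hUs⟩
  · by_cases hVU' : V = U
    · exact Or.inl hVU'
    · right; right
      refine ⟨hVU.trans h₁, ?_⟩
      have hlt : V.card < U.card := Finset.card_lt_card (lt_of_le_of_ne hVU hVU')
      omega
  · by_cases hVU' : V = U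
    · exact Or.inr (Or.inl hVU')
    · right; right
      refine ⟨hVU.trans h₂, ?_⟩
      have hlt : V.card < U.card := Finset.card_lt_card (lt_of_le_of_ne hVU hVU')
      omega
  · exact Or.inr (Or.inr ⟨hVU.trans hUC, (Finset.card_le_card hVU).trans hUs⟩)

/-- The deletion family at a coordinate `a ∈ X₁ ∖ X₂` (top-degree one): `B_s(C ∖ a) ∪ {X₂}`. -/
theorem deletion_twoTops (C X₁ X₂ : Finset (Fin h)) (s : ℕ) (a : Fin h) (ha₁ : a ∈ X₁) (ha₂ : a ∉ X₂) :
    {U | U ∈ ((↑(insert X₁ (insert X₂ (C.powerset.filter fun U => U.card ≤ s))) : Set (Finset (Fin h)))) ∧ a ∉ U} =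
      ↑(insert X₂ ((C.erase a).powerset.filter fun U => U.card ≤ s)) := by
  ext U
  simp only [Set.mem_setOf_eq, Finset.coe_insert, Set.mem_insert_iff, Finset.mem_coe, mem_ballF, Finset.subset_erase]
  constructor
  · rintro ⟨rfl | rfl | ⟨hUC, hUs⟩, haU⟩
    · exact absurd ha₁ haU
    · exact Or.inl rfl
    · exact Or.inr ⟨⟨hUC, haU⟩, hUs⟩
  · rintro (rfl | ⟨⟨hUC, haU⟩, hUs⟩)
    · exact ⟨Or.inr (Or.inl rfl), ha₂⟩
    · exact ⟨Or.inr (Or.inr ⟨hUC, hUs⟩), haU⟩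

/-- The link family at a coordinate `a ∈ X₁ ∖ X₂` (`s ≥ 1`): `B_{s−1}(C ∖ a) ∪ {X₁ ∖ a}`. -/
theorem link_twoTops (C X₁ X₂ : Finset (Fin h)) (s : ℕ) (a : Fin h) (ha₁ : a ∈ X₁) (ha₂ : a ∉ X₂) (h₁ : X₁ ⊆ C) :
    (fun U => U.erase a) ''
        {U | U ∈ ((↑(insert X₁ (insert X₂ (C.powerset.filter fun U => U.card ≤ s + 1))) : Set (Finset (Fin h)))) ∧ a ∈ U} =
      ↑(insert (X₁.erase a) ((C.erase a).powerset.filter fun U => U.card ≤ s)) := by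
  ext V
  simp only [Set.mem_image, Set.mem_setOf_eq, Finset.coe_insert, Set.mem_insert_iff, Finset.mem_coe, mem_ballF,
    Finset.subset_erase]
  constructor
  · rintro ⟨U, ⟨rfl | rfl | ⟨hUC, hUs⟩, haU⟩, rfl⟩
    · exact Or.inl rfl
    · exact absurd haU ha₂
    · right
      refine ⟨⟨(Finset.erase_subset a U).trans hUC, Finset.notMem_erase a U⟩, ?_⟩
      have := Finset.card_erase_of_mem haU
      omega
  · rintro (rfl | ⟨⟨hVC, haV⟩, hVs⟩)
    · exact ⟨X₁, ⟨Or.inl rfl, ha₁⟩, rfl⟩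
    · refine ⟨insert a V, ⟨Or.inr (Or.inr ⟨?_, ?_⟩), Finset.mem_insert_self a V⟩, Finset.erase_insert haV⟩
      · exact Finset.insert_subset (h₁ ha₁) hVC
      · rw [Finset.card_insert_of_notMem haV]; omega

/-- A transposition is an involution on sets. -/
theorem map_swap_swap (a b : Fin h) (Z : Finset (Fin h)) :
    (Z.map (Equiv.swap a b).toEmbedding).map (Equiv.swap a b).toEmbedding = Z := by
  ext x
  simp only [Finset.mem_map, Equiv.toEmbedding_apply]
  constructor
  · rintro ⟨y, ⟨z, hz, rfl⟩, rfl⟩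
    rwa [Equiv.swap_apply_self]
  · intro hx
    exact ⟨Equiv.swap a b x, ⟨x, hx, rfl⟩, Equiv.swap_apply_self _ _ _⟩

/-- The transposition `(a b)` (`a, b ∈ C`) carries subsets of `C ∖ b` to subsets of `C ∖ a`. -/
theorem map_swap_subset_erase (C Z : Finset (Fin h)) (a b : Fin h) (ha : a ∈ C) (hb : b ∈ C) (hZ : Z ⊆ C.erase b) :
    Z.map (Equiv.swap a b).toEmbedding ⊆ C.erase a := by
  rw [← map_swap_erase C a b ha hb]
  exact Finset.map_subset_map.mpr hZ

/-- Two distinct sets of the same size: the first has an element outside the second. -/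
theorem exists_mem_not_mem_of_ne {X₁ X₂ : Finset (Fin h)} (hne : X₁ ≠ X₂) (hcard : X₁.card = X₂.card) :
    ∃ a, a ∈ X₁ ∧ a ∉ X₂ := by
  by_contra hcon
  push Not at hcon
  exact hne (Finset.eq_of_subset_of_card_le (fun x hx => hcon x hx) (by omega))

/-! ## 2. The two-tops theorem -/

variable {K : ℕ}

/-- **CONJECTURE FJ FOR ALL TWO-TOP PAIRS.** For `X₁ ≠ X₂`, `Y₁ ≠ Y₂` subsets of `C` of size `s + 1` and any injective enumerations
`u`, `w` of `B_s(C) ∪ {X₁, X₂}`, `B_s(C) ∪ {Y₁, Y₂}`, the one-cube full hidden sum is nonsingular for some table with `h + s + 2` states. -/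
theorem fullJoinCube_twoTops (s : ℕ) (C X₁ X₂ Y₁ Y₂ : Finset (Fin h))
    (hX₁C : X₁ ⊆ C) (hX₂C : X₂ ⊆ C) (hY₁C : Y₁ ⊆ C) (hY₂C : Y₂ ⊆ C)
    (hX₁ : X₁.card = s + 1) (hX₂ : X₂.card = s + 1) (hY₁ : Y₁.card = s + 1) (hY₂ : Y₂.card = s + 1)
    (hX : X₁ ≠ X₂) (hY : Y₁ ≠ Y₂) (r : ℕ) (u w : Fin r → Finset (Fin h))
    (hu : Function.Injective u) (hw : Function.Injective w)
    (hru : Set.range u = ↑(insert X₁ (insert X₂ (C.powerset.filter fun U => U.card ≤ s))))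
    (hrw : Set.range w = ↑(insert Y₁ (insert Y₂ (C.powerset.filter fun U => U.card ≤ s)))) :
    ∃ (tx ty : Option (Fin (h + s + 2)) → Fin h → ℂ) (lam : Fin (h + s + 2) → ℂ),
      (Matrix.of fun i j : Fin r => ∑ J : Finset (Fin (h + s + 2)), (∏ q ∈ J, lam q) *
        ((∏ a ∈ u i, (tx none a + ∑ q ∈ J, tx (some q) a)) *
          ∏ c ∈ w j, (ty none c + ∑ q ∈ J, ty (some q) c))).det ≠ 0 := by
  classical
  obtain ⟨a, ha₁, ha₂⟩ := exists_mem_not_mem_of_ne hX (by omega)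
  obtain ⟨b, hb₁, hb₂⟩ := exists_mem_not_mem_of_ne hY (by omega)
  have haC : a ∈ C := hX₁C ha₁
  have hbC : b ∈ C := hY₁C hb₁
  -- the case `s = 0`: three rows, a star leaf
  rcases Nat.eq_zero_or_pos s with hs0 | hspos
  · subst hs0
    have hr : r ≤ h + 0 + 2 + 1 := by
      have hball : (C.powerset.filter fun U => U.card ≤ 0) ⊆ {∅} := by
        intro U hU
        rw [mem_ballF] at hU
        rw [Finset.mem_singleton]
        exact Finset.card_eq_zero.mp (Nat.le_zero.mp hU.2)
      have hF : (insert X₁ (insert X₂ (C.powerset.filter fun U => U.card ≤ 0))).card ≤ 3 := by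
        calc (insert X₁ (insert X₂ (C.powerset.filter fun U => U.card ≤ 0))).card
            ≤ (insert X₂ (C.powerset.filter fun U => U.card ≤ 0)).card + 1 := Finset.card_insert_le _ _
          _ ≤ (C.powerset.filter fun U => U.card ≤ 0).card + 1 + 1 := by gcongr; exact Finset.card_insert_le _ _
          _ ≤ ({∅} : Finset (Finset (Fin h))).card + 1 + 1 := by gcongr
          _ = 3 := by simp
      have hru' : ∀ i ∈ (Finset.univ : Finset (Fin r)),
          u i ∈ insert X₁ (insert X₂ (C.powerset.filter fun U => U.card ≤ 0)) := by
        intro i _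
        have := Set.mem_range_self (f := u) i
        rw [hru] at this
        exact this
      have := Finset.card_le_card_of_injOn u hru' (hu.injOn)
      rw [Finset.card_univ, Fintype.card_fin] at this
      omega
    exact fullJoinCube_of_le u w hu hw hr
  -- the case `s = s' + 1`
  obtain ⟨s', rfl⟩ : ∃ s', s = s' + 1 := ⟨s - 1, by omega⟩
  set σ : Equiv.Perm (Fin h) := Equiv.swap a b with hσ
  -- the six families (all over `C ∖ a` except the two column-side ones over `C ∖ b`)
  set FDa : Finset (Finset (Fin h)) := insert X₂ ((C.erase a).powerset.filter fun U => U.card ≤ s' + 1) with hFDa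
  set FDa' : Finset (Finset (Fin h)) :=
    insert (Y₂.map σ.toEmbedding) ((C.erase a).powerset.filter fun U => U.card ≤ s' + 1) with hFDa'
  set FDb : Finset (Finset (Fin h)) := insert Y₂ ((C.erase b).powerset.filter fun U => U.card ≤ s' + 1) with hFDb
  set FLa : Finset (Finset (Fin h)) := insert (X₁.erase a) ((C.erase a).powerset.filter fun U => U.card ≤ s') with hFLa
  set FLa' : Finset (Finset (Fin h)) :=
    insert ((Y₁.erase b).map σ.toEmbedding) ((C.erase a).powerset.filter fun U => U.card ≤ s') with hFLa'
  set FLb : Finset (Finset (Fin h)) := insert (Y₁.erase b) ((C.erase b).powerset.filter fun U => U.card ≤ s') with hFLb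
  -- relabelling by the transposition `(a b)`
  have hswap' : (C.erase a).map σ.toEmbedding = C.erase b := by
    rw [hσ, Equiv.swap_comm]; exact map_swap_erase C b a hbC haC
  have hmapD : FDa'.map (Finset.mapEmbedding σ.toEmbedding).toEmbedding = FDb := by
    rw [hFDa', hFDb, Finset.map_insert, map_ballF, hswap']
    simp only [RelEmbedding.coe_toEmbedding, Finset.mapEmbedding_apply, hσ, map_swap_swap]
  have hmapL : FLa'.map (Finset.mapEmbedding σ.toEmbedding).toEmbedding = FLb := by
    rw [hFLa', hFLb, Finset.map_insert, map_ballF, hswap']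
    simp only [RelEmbedding.coe_toEmbedding, Finset.mapEmbedding_apply, hσ, map_swap_swap]
  -- containments and cardinalities of the tops
  have hX₂Ca : X₂ ⊆ C.erase a := fun x hx => Finset.mem_erase.mpr ⟨fun h' => ha₂ (h' ▸ hx), hX₂C hx⟩
  have hY₂Cb : Y₂ ⊆ C.erase b := fun y hy => Finset.mem_erase.mpr ⟨fun h' => hb₂ (h' ▸ hy), hY₂C hy⟩
  have hY₂σ : Y₂.map σ.toEmbedding ⊆ C.erase a := map_swap_subset_erase C Y₂ a b haC hbC hY₂Cb
  have hX₁aC : X₁.erase a ⊆ C.erase a := Finset.erase_subset_erase a hX₁C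
  have hY₁bσ : (Y₁.erase b).map σ.toEmbedding ⊆ C.erase a :=
    map_swap_subset_erase C (Y₁.erase b) a b haC hbC (Finset.erase_subset_erase b hY₁C)
  have hY₂σcard : (Y₂.map σ.toEmbedding).card = s' + 1 + 1 := by rw [Finset.card_map, hY₂]
  have hX₁acard : (X₁.erase a).card = s' + 1 := by rw [Finset.card_erase_of_mem ha₁]; omega
  have hY₁bσcard : ((Y₁.erase b).map σ.toEmbedding).card = s' + 1 := by
    rw [Finset.card_map, Finset.card_erase_of_mem hb₁]; omega
  have hX₂_nm : X₂ ∉ ((C.erase a).powerset.filter fun U => U.card ≤ s' + 1) := by rw [mem_ballF]; omega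
  have hY₂σ_nm : Y₂.map σ.toEmbedding ∉ ((C.erase a).powerset.filter fun U => U.card ≤ s' + 1) := by
    rw [mem_ballF]; omega
  have hX₁a_nm : X₁.erase a ∉ ((C.erase a).powerset.filter fun U => U.card ≤ s') := by rw [mem_ballF]; omega
  have hY₁bσ_nm : (Y₁.erase b).map σ.toEmbedding ∉ ((C.erase a).powerset.filter fun U => U.card ≤ s') := by
    rw [mem_ballF]; omega
  have hcardD' : FDa'.card = FDa.card := by
    rw [hFDa', hFDa, Finset.card_insert_of_notMem hX₂_nm, Finset.card_insert_of_notMem hY₂σ_nm]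
  have hcardD : FDb.card = FDa.card := by rw [← hmapD, Finset.card_map, hcardD']
  have hcardL' : FLa'.card = FLa.card := by
    rw [hFLa', hFLa, Finset.card_insert_of_notMem hX₁a_nm, Finset.card_insert_of_notMem hY₁bσ_nm]
  have hcardL : FLb.card = FLa.card := by rw [← hmapL, Finset.card_map, hcardL']
  -- enumerations
  obtain ⟨uD, huD, hruD⟩ := exists_enum FDa
  obtain ⟨wD, hwD, hrwD⟩ : ∃ e : Fin FDa.card → Finset (Fin h), Function.Injective e ∧ Set.range e = ↑FDb := by
    rw [← hcardD]; exact exists_enum FDb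
  obtain ⟨wD', hwD', hrwD'⟩ : ∃ e : Fin FDa.card → Finset (Fin h), Function.Injective e ∧ Set.range e = ↑FDa' := by
    rw [← hcardD']; exact exists_enum FDa'
  obtain ⟨uL, huL, hruL⟩ := exists_enum FLa
  obtain ⟨wL, hwL, hrwL⟩ : ∃ e : Fin FLa.card → Finset (Fin h), Function.Injective e ∧ Set.range e = ↑FLb := by
    rw [← hcardL]; exact exists_enum FLb
  obtain ⟨wL', hwL', hrwL'⟩ : ∃ e : Fin FLa.card → Finset (Fin h), Function.Injective e ∧ Set.range e = ↑FLa' := by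
    rw [← hcardL']; exact exists_enum FLa'
  -- the step
  refine fullJoinCube_step_of_ranges u w hu hw ?_ a b uD wD uL wL huD hwD huL hwL ?_ ?_ ?_ ?_ ?_ ?_
  · rw [hru]; exact isLowerSet_twoTops C X₁ X₂ (s' + 1) hX₁C hX₂C hX₁ hX₂
  · rw [hruD, hru, hFDa]; exact (deletion_twoTops C X₁ X₂ (s' + 1) a ha₁ ha₂).symm
  · rw [hrwD, hrw, hFDb]; exact (deletion_twoTops C Y₁ Y₂ (s' + 1) b hb₁ hb₂).symm
  · rw [hruL, hru, hFLa]; exact (link_twoTops C X₁ X₂ s' a ha₁ ha₂ hX₁C).symm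
  · rw [hrwL, hrw, hFLb]; exact (link_twoTops C Y₁ Y₂ s' b hb₁ hb₂ hY₁C).symm
  · -- deletion pair: a first-shell pair over `C ∖ a` after relabelling the columns, then pad
    have hn : (X₂ \ Y₂.map σ.toEmbedding).card ≤ s' + 1 + 1 :=
      le_trans (Finset.card_le_card Finset.sdiff_subset) hX₂.le
    have H2 := fullJoinCube_firstShell (X₂ \ Y₂.map σ.toEmbedding).card (s' + 1) (C.erase a) X₂ (Y₂.map σ.toEmbedding)
      hX₂Ca hY₂σ hX₂ hY₂σcard rfl FDa.card uD wD' huD hwD' (by rw [hruD]) (by rw [hrwD'])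
    have H3 := fullJoinCube_relabel_range σ uD wD' wD huD hwD (by
      rw [hrwD, hrwD', ← coe_map_mapEmbedding, hmapD]) H2
    exact fullJoinCube_pad_le uD wD (by omega : h + (X₂ \ Y₂.map σ.toEmbedding).card ≤ h + s' + 1 + 1) H3
  · -- link pair: a first-shell pair over `C ∖ a` (radius `s'`) after relabelling the columns, then pad
    have hn : (X₁.erase a \ (Y₁.erase b).map σ.toEmbedding).card ≤ s' + 1 :=
      le_trans (Finset.card_le_card Finset.sdiff_subset) hX₁acard.le
    have H4 := fullJoinCube_firstShell (X₁.erase a \ (Y₁.erase b).map σ.toEmbedding).card s' (C.erase a) (X₁.erase a)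
      ((Y₁.erase b).map σ.toEmbedding) hX₁aC hY₁bσ hX₁acard hY₁bσcard rfl FLa.card uL wL' huL hwL'
      (by rw [hruL]) (by rw [hrwL'])
    have H5 := fullJoinCube_relabel_range σ uL wL' wL huL hwL (by
      rw [hrwL, hrwL', ← coe_map_mapEmbedding, hmapL]) H4
    exact fullJoinCube_pad_le uL wL (by omega : h + (X₁.erase a \ (Y₁.erase b).map σ.toEmbedding).card ≤ h + s' + 1 + 1) H5

/-- **Every two-tops layout is hit** (item 19717's conclusion with `b = 8` for this family): for `h ≥ 3`. -/
theorem partitionMinor_hit_twoTops {r : ℕ} (hh : 3 ≤ h) (s : ℕ) (C X₁ X₂ Y₁ Y₂ : Finset (Fin h))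
    (hX₁C : X₁ ⊆ C) (hX₂C : X₂ ⊆ C) (hY₁C : Y₁ ⊆ C) (hY₂C : Y₂ ⊆ C)
    (hX₁ : X₁.card = s + 1) (hX₂ : X₂.card = s + 1) (hY₁ : Y₁.card = s + 1) (hY₂ : Y₂.card = s + 1)
    (hX : X₁ ≠ X₂) (hY : Y₁ ≠ Y₂) (u w : Fin r → Finset (Fin h))
    (hu : Function.Injective u) (hw : Function.Injective w)
    (hru : Set.range u = ↑(insert X₁ (insert X₂ (C.powerset.filter fun U => U.card ≤ s))))
    (hrw : Set.range w = ↑(insert Y₁ (insert Y₂ (C.powerset.filter fun U => U.card ≤ s)))) :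
    ∃ f ∈ Literature.Barriers.ValiantsHypothesis.SmallCircuits ℂ (h + h) 8,
      (Matrix.of fun i j : Fin r => MvPolynomial.coeff
        (∑ a ∈ u i, Finsupp.single (Fin.castAdd h a) 1 +
          ∑ c ∈ w j, Finsupp.single (Fin.natAdd h c) 1) f).det ≠ 0 := by
  have hs : s + 1 ≤ h :=
    calc s + 1 = X₁.card := hX₁.symm
      _ ≤ Fintype.card (Fin h) := Finset.card_le_univ X₁
      _ = h := Fintype.card_fin h
  refine partitionMinor_hit_of_oneCube hh ?_ u w
    (fullJoinCube_twoTops s C X₁ X₂ Y₁ Y₂ hX₁C hX₂C hY₁C hY₂C hX₁ hX₂ hY₁ hY₂ hX hY r u w hu hw hru hrw)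
  calc h + s + 2 ≤ h + h + 1 := by omega
    _ ≤ h * h := by nlinarith
    _ = h * h * 1 := by ring
    _ ≤ h * h * h := by gcongr; omega

end FullJoin

end

end Summit.ValiantsHypothesis.ValiantsHypothesis.Theorems.BarrierLever.HiddenStates
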